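import Literature.NumberTheory.Sieve.MoebiusWalshCircuitsProofs
import Literature.NumberTheory.LFunctions.MoebiusWalshTypeIIHighBox
import HarnessLib

/-!
# Bourgain 2013, Theorem 1 for `λ` — discharge of `bourgain_liouville_walsh`

Topic `Literature/NumberTheory/Sieve`, a proofs companion of `MoebiusWalshCircuits.lean` (named fact
`bourgain_liouville_walsh`: J. Bourgain, *Möbius–Walsh correlation bounds and an estimate of Mauduit
and Rivat*, J. Anal. Math. **119** (2013) 147–163 = arXiv:1109.2784 [Bourgain2013MoebiusWalsh],
Theorem 1, the parenthetical remark "(a similar estimate is also valid for the Liouville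
function)"). Everything here is PROVED (one theorem; no definition, no named fact).

`Literature.NumberTheory.Sieve.bourgain_liouville_walsh` ("there is `c > 0` such that for `n` large
enough and every `A ⊆ {0,…,n-1}`, `|∑_{x<2^n} λ(x) w_A(x)| ≤ 2^{n-n^c}`", in the
`range (2^n)`/`testBit` vocabulary, `∀ᶠ n`) follows from the `LFunctions` vendoring
`Literature.NumberTheory.LFunctions.bourgain_liouville_walsh_uniform` (exponent `1/10`, strict
inequality, cube sum `walshSum`, `∃ n₀`) by the proved bridge
`Literature.NumberTheory.Sieve.bourgain_liouville_walsh_of_uniform`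
(`MoebiusWalshCircuitsProofs.lean`: binary expansion is a bijection `{0,1}ⁿ ≃ [0, 2ⁿ)`, take
`c = 1/10`). The latter is PROVED in the tree
(`Literature.NumberTheory.LFunctions.bourgain_liouville_walsh_uniform_holds`,
`LFunctions/MoebiusWalshTypeIIHighBox.lean`: Green's Proposition 1 for the small weights
(`LiouvilleWalshSmallWeight`), the Vaughan-type reduction for `λ` (`LiouvilleWalshVaughan`),
Bourgain's §1 Fourier lemmas, the type-I (§3) and type-II (§2) box estimates and the numerics of
(3.10), assembled in `LiouvilleWalsh.bourgain_liouville_walsh_uniform_of_typeII`); this file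
transports that discharge. It is the `λ`-companion of `MoebiusWalshCircuitsHolds.lean` (`μ`).

## References

* J. Bourgain, J. Anal. Math. 119 (2013) 147–163; arXiv:1109.2784, Theorem 1, (0.3) and the
  Liouville remark following it. [Bourgain2013MoebiusWalsh]
-/

namespace Literature.NumberTheory.Sieve

/-- **Bourgain 2013, Theorem 1 (Liouville–Walsh) — PROVED** (discharge of the named fact
`bourgain_liouville_walsh`): there is `c > 0` (namely `c = 1/10`) such that for all sufficiently
large `n` and every `A ⊆ {0,…,n-1}`, `|∑_{x<2ⁿ} λ(x) w_A(x)| ≤ 2^{n - n^c}`,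
`w_A(x) = ∏_{j ∈ A} (1 - 2x_j)`. Transported from the `LFunctions` form
`Literature.NumberTheory.LFunctions.bourgain_liouville_walsh_uniform_holds` through the proved
implication `bourgain_liouville_walsh_of_uniform`.
[cite: Bourgain2013MoebiusWalsh, Theorem 1 (Liouville remark)] -/
theorem bourgain_liouville_walsh_holds : bourgain_liouville_walsh :=
  bourgain_liouville_walsh_of_uniform
    Literature.NumberTheory.LFunctions.bourgain_liouville_walsh_uniform_holds

end Literature.NumberTheory.Sieve
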